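import Literature.Analysis.Quadrature.LatticeRules

/-!
# Lattice rules for periodic functions analytic in a polystrip

Let `𝕋ˢ = (ℝ/ℤ)ˢ` (`UnitAddTorus (Fin s)`, Haar probability measure), `Q_{n,z}(f) = (1/n) Σ_i f(x_i)`
the `n`-point rank-1 lattice rule with generating vector `z ∈ ℤˢ` and `L⊥ = {h : h · z ≡ 0 (mod n)}`
its dual lattice (`Literature.Analysis.Quadrature.LatticeRules`).  This file formalises the
classical error bound for lattice rules applied to periodic integrands that extend analytically
to a **polystrip** `{z ∈ ℂˢ : |Im z_j| < a_j}` — the several-variable analogue of the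
"trapezoidal rule for periodic analytic functions" (`TrapezoidalRulePeriodic`, `s = 1`, `z = 1`).

* `norm_mFourierCoeff_le_of_analytic_polystrip` — **exponential decay of the Fourier
  coefficients** [cite: Gallavotti1983, §5.11 Prop. 18(iii), eq. (5.11.15)] (there for a common
  width `ξ` and in multiplicative notation `z_j = e^{iφ_j}` on the multi-annulus `C(ξ)` of
  Def. 8, eq. (5.11.3): `|h_ν| ≤ |h|_ξ e^{-ξ|ν|}`, `|ν| = Σ_j |ν_j|`; for one variable
  [cite: TrefethenWeideman2014, eq. (4.11)]): if `F : ℂˢ → ℂ` is `1`-periodic in each variable,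
  complex-differentiable on the open polystrip `|Im z_j| < a_j` (`a_j > 0`) and `‖F‖ ≤ M` there,
  and `f ∈ C(𝕋ˢ)` is its restriction to real arguments, then
  `‖f̂(h)‖ ≤ M e^{-2π Σ_j a_j |h_j|}` for every `h ∈ ℤˢ`.
  The proof is the textbook contour shift, one coordinate at a time: writing
  `f̂(h) = ∫_{[0,1]ˢ} F(x) e^{-2πi h·x} dx`, the `j`-th integration segment is moved to
  `Im z_j = y_j` with `|y_j| < a_j` (Fubini, `MeasureTheory.measurePreserving_piFinSuccAbove`, and
  Cauchy's theorem on a rectangle, `Complex.integral_boundary_rect_eq_zero_of_differentiableOn`,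
  whose vertical sides cancel by periodicity); the shifted integrand has modulus
  `≤ M e^{2π Σ_j h_j y_j}`; choosing `y_j = -r a_j sgn(h_j)` and letting `r → 1⁻` gives the claim.
* `summable_mFourierCoeff_of_analytic_polystrip` — hence `Σ_h ‖f̂(h)‖ < ∞`
  [cite: Gallavotti1983, §5.11 Prop. 18(iv)], the weights `w_a(h) = e^{-2π Σ_j a_j|h_j|} = ∏_j q_j^{|h_j|}`,
  `q_j = e^{-2π a_j}`, being summable over `ℤˢ` with
  `Σ_{h ∈ ℤˢ} w_a(h) ≤ ∏_j (1 + q_j)/(1 - q_j)` (`hasSum_int_exp_neg_mul_abs`,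
  `summable_exp_neg_polystrip`, `tsum_exp_neg_polystrip_le`; the product computation in the proof
  of [cite: Pillichshammer2021, Prop. 2]).
* `norm_latticeRule_sub_integral_le_of_analytic_polystrip` — **the lattice-rule bound**: by the
  dual-lattice error formula [cite: Niederreiter1992, eq. (5.4)] in its comparison form
  (`norm_latticeRule_sub_integral_le_of_le`, the shape of [cite: Niederreiter1992, Thm. 5.3]),
  `‖Q_{n,z}(f) - ∫_{𝕋ˢ} f‖ ≤ M · Σ_{0 ≠ h ∈ L⊥} e^{-2π Σ_j a_j |h_j|}`,
  and the same bound for every shifted rule `(1/n) Σ_i f(x_i + Δ)`, `Δ ∈ 𝕋ˢ`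
  (`norm_latticeRule_shift_sub_integral_le_of_analytic_polystrip`; a translate has Fourier
  coefficients of the same modulus and the same integral).  The dual-lattice sum on the right is
  the squared worst-case error of `Q_{n,z}` in the Korobov space of analytic functions with
  weights `ω^{a_j|h_j|}` [cite: Pillichshammer2021, Lemma 1]; for the sup-norm class used here it
  bounds the error linearly.
* `tsum_dualLattice_exp_neg_polystrip_le_box_add_tail` — a **finitely checkable majorant** of that
  sum: for every box `B(H) = ∏_j [-H_j, H_j] ∩ ℤ`,
  `Σ_{0 ≠ h ∈ L⊥} w_a(h) ≤ Σ_{0 ≠ h ∈ L⊥ ∩ B(H)} w_a(h) + Σ_j [2 q_j^{H_j+1}/(1 - q_j)] ∏_{i ≠ j} (1 + q_i)/(1 - q_i)`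
  (outside the box the congruence is dropped and a union bound over the coordinate leaving the
  box is taken; elementary).

Design notes.  The index type of the analytic statements is `Fin s` (the contour shift iterates
over coordinates via `Fin.insertNth`); the weight lemmas are stated for any `Fintype` index.
Hypotheses are on the OPEN polystrip, jointly in all variables (`DifferentiableOn ℂ F`), with a
global bound `M` there — the form in which the bound is used to certify a lattice rule from a
claimed strip of analyticity; nothing is assumed on the boundary.  Not formalised here: the exact
value `Σ_{h ∈ ℤˢ} w_a(h) = ∏_j (1+q_j)/(1-q_j)` as a `HasSum` over `ℤˢ` (only the upper bound, which
is what a certificate needs), the one-dimensional closed form `Σ_{0 ≠ h ∈ mℤ} q^{|h|} = 2q^m/(1-q^m)`,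
and existence results for good generating vectors (see `KorobovClasses`, `GoodLatticePoints`).

## References

* G. Gallavotti, *The Elements of Mechanics*, Springer 1983, §5.11, Definition 8 (eqs.
  (5.11.1)–(5.11.3)) and Proposition 18 (iii)–(iv) (eq. (5.11.15)). [cite: Gallavotti1983, §5.11 Prop. 18]
* L. N. Trefethen, J. A. C. Weideman, *The exponentially convergent trapezoidal rule*, SIAM Review
  **56** (2014) 385–458, §4, eq. (4.11) and Thm. 4.2 (one variable). [cite: TrefethenWeideman2014, eq. (4.11)]
* H. Niederreiter, *Random Number Generation and Quasi-Monte Carlo Methods*, SIAM 1992, §5.1,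
  eq. (5.4) and Thm. 5.3. [cite: Niederreiter1992, Thm. 5.3]
* F. Pillichshammer, *A note on Korobov lattice rules for integration of analytic functions*,
  J. Complexity **63** (2021) 101524 (arXiv:2010.03286), Lemma 1 and the proof of Prop. 2.
  [cite: Pillichshammer2021, Lemma 1]

AI-produced formalisation (H21 engines group, seat eng-quad-3, 2026-08-21); no facts, no axioms
beyond Mathlib's, no `sorry`.
-/

open scoped Real Interval
open MeasureTheory Complex Finset Set Filter Topology UnitAddTorus

noncomputable section

namespace Literature.Analysis.Quadrature

/-- As in `Mathlib.Analysis.Fourier.AddCircleMulti` and `LatticeRules`: the measure on `ℝ / ℤ` has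
total mass `1` (local instance). [folklore] -/
local instance latticeRulesAnalytic_measureSpace : MeasureSpace UnitAddCircle :=
  ⟨AddCircle.haarAddCircle⟩

/-- The measure on `ℝ / ℤ` is a Haar measure. [folklore] -/
local instance latticeRulesAnalytic_isAddHaarMeasure :
    Measure.IsAddHaarMeasure (volume : Measure UnitAddCircle) :=
  inferInstanceAs (Measure.IsAddHaarMeasure AddCircle.haarAddCircle)

/-- The measure on `ℝ / ℤ` is a probability measure. [folklore] -/
local instance latticeRulesAnalytic_isProbabilityMeasure :
    IsProbabilityMeasure (volume : Measure UnitAddCircle) :=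
  inferInstanceAs (IsProbabilityMeasure AddCircle.haarAddCircle)

/-! ### One variable: shifting the segment `[0, 1]` vertically inside the strip -/

/-- **Contour shift for a `1`-periodic function analytic in a strip**: if `Φ` is `1`-periodic and
analytic in `|Im w| < a`, then `∫₀¹ Φ(t + i y) dt` does not depend on `y ∈ (-a, a)` (Cauchy's
theorem on the rectangle `[0, 1] × [y₁, y₂]`; the vertical sides cancel by periodicity).
[folklore] -/
private theorem intervalIntegral_add_mul_I_eq {Φ : ℂ → ℂ} {a y₁ y₂ : ℝ}
    (hd : DifferentiableOn ℂ Φ {w : ℂ | |w.im| < a}) (hper : ∀ w : ℂ, Φ (w + 1) = Φ w)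
    (hy₁ : |y₁| < a) (hy₂ : |y₂| < a) :
    ∫ t in (0 : ℝ)..1, Φ (t + y₁ * I) = ∫ t in (0 : ℝ)..1, Φ (t + y₂ * I) := by
  have hre1 : ((y₁ : ℂ) * I).re = 0 := by simp
  have him1 : ((y₁ : ℂ) * I).im = y₁ := by simp
  have hre2 : ((1 : ℂ) + y₂ * I).re = 1 := by simp
  have him2 : ((1 : ℂ) + y₂ * I).im = y₂ := by simp
  have H : DifferentiableOn ℂ Φ
      ([[((y₁ : ℂ) * I).re, ((1 : ℂ) + y₂ * I).re]] ×ℂ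
        [[((y₁ : ℂ) * I).im, ((1 : ℂ) + y₂ * I).im]]) := by
    refine hd.mono fun w hw => ?_
    rw [hre1, him1, hre2, him2, mem_reProdIm] at hw
    have h2 := hw.2
    show |w.im| < a
    rw [abs_lt] at hy₁ hy₂ ⊢
    rcases mem_uIcc.mp h2 with ⟨h1, h2⟩ | ⟨h1, h2⟩ <;> constructor <;> linarith
  have key := Complex.integral_boundary_rect_eq_zero_of_differentiableOn Φ _ _ H
  rw [hre1, him1, hre2, him2] at key
  simp only [ofReal_one, ofReal_zero, zero_add] at key
  have hv : (∫ y in y₁..y₂, Φ (1 + y * I)) = ∫ y in y₁..y₂, Φ (y * I) :=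
    intervalIntegral.integral_congr fun y _ => by rw [add_comm]; exact hper _
  rw [hv] at key
  linear_combination key

/-! ### Several variables: notation -/

variable {s : ℕ}

/-- The point `x + i y ∈ ℂˢ` with real part `x` and imaginary part `y`. [folklore] -/
private def shiftPt (x y : Fin s → ℝ) : Fin s → ℂ := fun j => (x j : ℂ) + (y j : ℂ) * I

/-- The integrand `F(x + iy) e^{-2πi h·(x + iy)}` of the shifted Fourier integral. [folklore] -/
private def integrand (F : (Fin s → ℂ) → ℂ) (h : Fin s → ℤ) (y x : Fin s → ℝ) : ℂ :=
  F (shiftPt x y) * cexp (-(2 * π * I * ∑ j, (h j : ℂ) * shiftPt x y j))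

/-- The half-open unit cube `(0, 1]ˢ`, a fundamental domain of `ℝˢ / ℤˢ`. [folklore] -/
private def unitBox (s : ℕ) : Set (Fin s → ℝ) := Set.pi univ fun _ => Ioc (0 : ℝ) 1

/-- The shifted Fourier integral `I(y) = ∫_{(0,1]ˢ} F(x + iy) e^{-2πi h·(x + iy)} dx`. [folklore] -/
private def boxInt (F : (Fin s → ℂ) → ℂ) (h : Fin s → ℤ) (y : Fin s → ℝ) : ℂ :=
  ∫ x in unitBox s, integrand F h y x

/-- Lebesgue measure restricted to `(0, 1]ˢ` is the product of `s` copies of Lebesgue measure on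
`(0, 1]`. [folklore] -/
private theorem volume_restrict_unitBox (s : ℕ) :
    (volume : Measure (Fin s → ℝ)).restrict (unitBox s) =
      Measure.pi fun _ : Fin s => (volume : Measure ℝ).restrict (Ioc 0 1) := by
  rw [unitBox, volume_pi, Measure.restrict_pi_pi]

/-- `(0, 1]ˢ` has Lebesgue measure `1`. [folklore] -/
private theorem volume_unitBox (s : ℕ) : volume (unitBox s) = 1 := by
  rw [unitBox, Real.volume_pi_Ioc]
  simp

/-- `x ↦ x + iy` is continuous. [folklore] -/
private theorem continuous_shiftPt (y : Fin s → ℝ) : Continuous fun x : Fin s → ℝ => shiftPt x y :=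
  continuous_pi fun j => (continuous_ofReal.comp (continuous_apply j)).add continuous_const

/-- Real part of the exponent: `Re(-2πi h·(x + iy)) = 2π h·y`. [folklore] -/
private theorem re_exponent (h : Fin s → ℤ) (x y : Fin s → ℝ) :
    (-(2 * π * I * ∑ j, (h j : ℂ) * shiftPt x y j)).re = 2 * π * ∑ j, (h j : ℝ) * y j := by
  simp [shiftPt, Complex.mul_re, Complex.mul_im, Complex.re_sum, mul_sum]

/-- `‖F(x + iy) e^{-2πi h·(x+iy)}‖ = ‖F(x + iy)‖ e^{2π h·y}`. [folklore] -/
private theorem norm_integrand (F : (Fin s → ℂ) → ℂ) (h : Fin s → ℤ) (y x : Fin s → ℝ) :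
    ‖integrand F h y x‖ = ‖F (shiftPt x y)‖ * Real.exp (2 * π * ∑ j, (h j : ℝ) * y j) := by
  rw [integrand, norm_mul, Complex.norm_exp, re_exponent]

/-- For `|y_j| < a_j` the integrand is continuous on `ℝˢ` (the shifted real torus lies inside the
polystrip). [folklore] -/
private theorem continuous_integrand {F : (Fin s → ℂ) → ℂ} {a : Fin s → ℝ}
    (hd : DifferentiableOn ℂ F {z | ∀ j, |(z j).im| < a j}) (h : Fin s → ℤ) {y : Fin s → ℝ}
    (hy : ∀ j, |y j| < a j) : Continuous (integrand F h y) := by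
  have hmaps : ∀ x : Fin s → ℝ, shiftPt x y ∈ {z : Fin s → ℂ | ∀ j, |(z j).im| < a j} := by
    intro x j
    simpa [shiftPt] using hy j
  have h1 : Continuous fun x : Fin s → ℝ => F (shiftPt x y) :=
    hd.continuousOn.comp_continuous (continuous_shiftPt y) hmaps
  refine h1.mul (Complex.continuous_exp.comp ?_)
  refine (continuous_const.mul (continuous_finsetSum _ fun j _ => ?_)).neg
  exact continuous_const.mul ((continuous_apply j).comp (continuous_shiftPt y))

/-- For `|y_j| < a_j` the integrand is integrable on `(0, 1]ˢ`. [folklore] -/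
private theorem integrableOn_integrand {F : (Fin s → ℂ) → ℂ} {a : Fin s → ℝ}
    (hd : DifferentiableOn ℂ F {z | ∀ j, |(z j).im| < a j}) (h : Fin s → ℤ) {y : Fin s → ℝ}
    (hy : ∀ j, |y j| < a j) : IntegrableOn (integrand F h y) (unitBox s) := by
  refine ((continuous_integrand hd h hy).continuousOn.integrableOn_compact
    (isCompact_Icc (a := (0 : Fin s → ℝ)) (b := 1))).mono_set ?_
  rw [unitBox, ← Set.pi_univ_Icc]
  exact Set.pi_mono fun _ _ => Ioc_subset_Icc_self

/-- `‖I(y)‖ ≤ M e^{2π h·y}` whenever `‖F‖ ≤ M` on the polystrip and `|y_j| < a_j`. [folklore] -/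
private theorem norm_boxInt_le {F : (Fin s → ℂ) → ℂ} {a : Fin s → ℝ} {M : ℝ}
    (hM : ∀ z : Fin s → ℂ, (∀ j, |(z j).im| < a j) → ‖F z‖ ≤ M) (h : Fin s → ℤ)
    {y : Fin s → ℝ} (hy : ∀ j, |y j| < a j) :
    ‖boxInt F h y‖ ≤ M * Real.exp (2 * π * ∑ j, (h j : ℝ) * y j) := by
  have hvol : volume.real (unitBox s) = 1 := by
    rw [measureReal_def, volume_unitBox, ENNReal.toReal_one]
  have H := norm_setIntegral_le_of_norm_le_const (μ := (volume : Measure (Fin s → ℝ)))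
    (s := unitBox s) (f := integrand F h y) (C := M * Real.exp (2 * π * ∑ j, (h j : ℝ) * y j))
    (by rw [volume_unitBox]; exact ENNReal.one_lt_top) fun x _ => by
      rw [norm_integrand]
      refine mul_le_mul_of_nonneg_right (hM _ fun j => ?_) (Real.exp_pos _).le
      simpa [shiftPt] using hy j
  rwa [hvol, mul_one] at H

/-! ### Several variables: shifting one coordinate (Fubini + the one-variable lemma) -/

/-- Splitting off the coordinate `i`: `x + iy` with `x = insertNth i t x'`. [folklore] -/
private theorem shiftPt_insertNth {m : ℕ} (i : Fin (m + 1)) (t : ℝ) (x' : Fin m → ℝ)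
    (y : Fin (m + 1) → ℝ) :
    shiftPt (i.insertNth t x') y =
      i.insertNth ((t : ℂ) + (y i : ℂ) * I)
        (fun k => (x' k : ℂ) + (y (i.succAbove k) : ℂ) * I) := by
  ext j
  rcases Fin.eq_self_or_eq_succAbove i j with rfl | ⟨k, rfl⟩
  · simp [shiftPt, Fin.insertNth_apply_same]
  · simp [shiftPt, Fin.insertNth_apply_succAbove]

/-- The map `w ↦ insertNth i w v` (vary one complex coordinate) is differentiable. [folklore] -/
private theorem differentiable_insertNth {m : ℕ} (i : Fin (m + 1)) (v : Fin m → ℂ) :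
    Differentiable ℂ fun w : ℂ => (i.insertNth w v : Fin (m + 1) → ℂ) := by
  refine differentiable_pi.mpr fun j => ?_
  rcases Fin.eq_self_or_eq_succAbove i j with rfl | ⟨k, rfl⟩
  · simp only [Fin.insertNth_apply_same]
    exact differentiable_id
  · simp only [Fin.insertNth_apply_succAbove]
    exact differentiable_const _

/-- `insertNth i (w + 1) v = insertNth i w v + e_i`. [folklore] -/
private theorem insertNth_add_one {m : ℕ} (i : Fin (m + 1)) (w : ℂ) (v : Fin m → ℂ) :
    (i.insertNth (w + 1) v : Fin (m + 1) → ℂ) = i.insertNth w v + Pi.single i 1 := by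
  ext j
  rcases Fin.eq_self_or_eq_succAbove i j with rfl | ⟨k, rfl⟩
  · simp [Fin.insertNth_apply_same]
  · simp [Fin.insertNth_apply_succAbove, Fin.succAbove_ne]

/-- `h · insertNth i w v = hᵢ w + Σ_k h_{succAbove i k} v_k`. [folklore] -/
private theorem sum_mul_insertNth {m : ℕ} (i : Fin (m + 1)) (h : Fin (m + 1) → ℤ) (w : ℂ)
    (v : Fin m → ℂ) :
    ∑ j, (h j : ℂ) * (i.insertNth w v : Fin (m + 1) → ℂ) j =
      (h i : ℂ) * w + ∑ k, (h (i.succAbove k) : ℂ) * v k := by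
  rw [Fin.sum_univ_succAbove _ i]
  simp [Fin.insertNth_apply_same, Fin.insertNth_apply_succAbove]

/-- **One coordinate may be shifted**: if `y, y'` are admissible imaginary parts (`|y_j|, |y'_j| <
a_j`) that agree off the coordinate `i`, then `I(y) = I(y')`. [folklore] -/
private theorem boxInt_eq_of_eq_off {F : (Fin s → ℂ) → ℂ} {a : Fin s → ℝ}
    (hd : DifferentiableOn ℂ F {z | ∀ j, |(z j).im| < a j})
    (hper : ∀ (z : Fin s → ℂ) (j : Fin s), F (z + Pi.single j 1) = F z) (h : Fin s → ℤ)
    (i : Fin s) {y y' : Fin s → ℝ} (hy : ∀ j, |y j| < a j) (hy' : ∀ j, |y' j| < a j)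
    (hoff : ∀ j, j ≠ i → y' j = y j) : boxInt F h y = boxInt F h y' := by
  obtain ⟨m, rfl⟩ : ∃ m, s = m + 1 := ⟨s - 1, by have := i.pos; omega⟩
  set ν : Measure ℝ := (volume : Measure ℝ).restrict (Ioc 0 1) with hν
  set π' : Measure (Fin m → ℝ) := Measure.pi fun _ : Fin m => ν with hπ'
  set e := MeasurableEquiv.piFinSuccAbove (fun _ : Fin (m + 1) => ℝ) i with he_def
  have he : MeasurePreserving e ((volume : Measure (Fin (m + 1) → ℝ)).restrict (unitBox (m + 1)))
      (ν.prod π') := by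
    rw [volume_restrict_unitBox]
    exact measurePreserving_piFinSuccAbove (fun _ : Fin (m + 1) => ν) i
  have hsymm : ∀ p : ℝ × (Fin m → ℝ), e.symm p = i.insertNth p.1 p.2 := by
    intro p
    simp [he_def, MeasurableEquiv.piFinSuccAbove_symm_apply, Fin.insertNthEquiv]
  -- both sides as iterated integrals, the coordinate `i` innermost
  have key : ∀ {w : Fin (m + 1) → ℝ}, (∀ j, |w j| < a j) →
      boxInt F h w = ∫ x', (∫ t in (0 : ℝ)..1, integrand F h w (i.insertNth t x')) ∂π' := by
    intro w hw
    have hint : Integrable (fun p : ℝ × (Fin m → ℝ) => integrand F h w (e.symm p)) (ν.prod π') :=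
      (he.symm.integrable_comp_emb e.symm.measurableEmbedding).mpr (integrableOn_integrand hd h hw)
    rw [boxInt, ← he.symm.integral_comp', integral_prod_symm _ hint]
    refine integral_congr_ae (Eventually.of_forall fun x' => ?_)
    simp only [hsymm]
    rw [intervalIntegral.integral_of_le zero_le_one, hν]
  rw [key hy, key hy']
  refine integral_congr_ae (Eventually.of_forall fun x' => ?_)
  -- the inner integrals agree by the one-variable lemma
  set v : Fin m → ℂ := fun k => (x' k : ℂ) + (y (i.succAbove k) : ℂ) * I with hv
  set C : ℂ := ∑ k, (h (i.succAbove k) : ℂ) * v k with hC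
  set Φ : ℂ → ℂ := fun w => F (i.insertNth w v) * cexp (-(2 * π * I * ((h i : ℂ) * w + C)))
    with hΦ
  have hoff' : ∀ k, y' (i.succAbove k) = y (i.succAbove k) := fun k =>
    hoff _ (Fin.succAbove_ne i k)
  have hΦy : ∀ t : ℝ, integrand F h y (i.insertNth t x') = Φ ((t : ℂ) + (y i : ℂ) * I) := by
    intro t
    simp only [integrand, shiftPt_insertNth, sum_mul_insertNth, hΦ, hv, hC]
  have hΦy' : ∀ t : ℝ, integrand F h y' (i.insertNth t x') = Φ ((t : ℂ) + (y' i : ℂ) * I) := by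
    intro t
    simp only [integrand, shiftPt_insertNth, sum_mul_insertNth, hΦ, hv, hC, hoff']
  simp only [hΦy, hΦy']
  refine intervalIntegral_add_mul_I_eq (a := a i) ?_ ?_ (hy i) (hy' i)
  · -- `Φ` is analytic in the strip `|Im w| < a i`
    have hmaps : Set.MapsTo (fun w : ℂ => i.insertNth w v) {w : ℂ | |w.im| < a i}
        {z : Fin (m + 1) → ℂ | ∀ j, |(z j).im| < a j} := by
      intro w hw j
      rcases Fin.eq_self_or_eq_succAbove i j with rfl | ⟨k, rfl⟩
      · simpa [Fin.insertNth_apply_same] using hw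
      · simpa [Fin.insertNth_apply_succAbove, hv] using hy (i.succAbove k)
    refine (hd.comp (differentiable_insertNth i v).differentiableOn hmaps).mul ?_
    refine (Complex.differentiable_exp.comp ?_).differentiableOn
    exact (((differentiable_const _).mul differentiable_id).add (differentiable_const _)).const_mul
      _ |>.neg
  · -- `Φ` is `1`-periodic
    intro w
    simp only [hΦ]
    rw [insertNth_add_one, hper]
    congr 1
    rw [show -(2 * π * I * ((h i : ℂ) * (w + 1) + C)) =
        -(2 * π * I * ((h i : ℂ) * w + C)) + ((-h i : ℤ) : ℂ) * (2 * π * I) by push_cast; ring,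
      Complex.exp_add, Complex.exp_int_mul_two_pi_mul_I, mul_one]

/-- **All coordinates may be shifted**: `I(y) = I(0)` for every admissible `y` (induction over the
coordinates, one at a time). [folklore] -/
private theorem boxInt_eq_boxInt_zero {F : (Fin s → ℂ) → ℂ} {a : Fin s → ℝ} (ha : ∀ j, 0 < a j)
    (hd : DifferentiableOn ℂ F {z | ∀ j, |(z j).im| < a j})
    (hper : ∀ (z : Fin s → ℂ) (j : Fin s), F (z + Pi.single j 1) = F z) (h : Fin s → ℤ)
    {y : Fin s → ℝ} (hy : ∀ j, |y j| < a j) : boxInt F h y = boxInt F h 0 := by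
  -- `Y k` = `y` on the coordinates `< k`, `0` elsewhere
  set Y : ℕ → Fin s → ℝ := fun k j => if (j : ℕ) < k then y j else 0 with hY
  have hYadm : ∀ k j, |Y k j| < a j := by
    intro k j
    simp only [hY]
    split_ifs
    · exact hy j
    · simpa using ha j
  have main : ∀ k : ℕ, boxInt F h (Y k) = boxInt F h 0 := by
    intro k
    induction k with
    | zero =>
      have : Y 0 = 0 := by funext j; simp [hY]
      rw [this]
    | succ k ih =>
      rw [← ih]
      by_cases hk : k < s
      · refine (boxInt_eq_of_eq_off hd hper h ⟨k, hk⟩ (hYadm (k + 1)) (hYadm k) fun j hj => ?_)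
        have hjk : (j : ℕ) ≠ k := fun H => hj (Fin.ext H)
        simp only [hY]
        by_cases h1 : (j : ℕ) < k
        · rw [if_pos h1, if_pos (by omega)]
        · rw [if_neg h1, if_neg (by omega)]
      · congr 1
        funext j
        have := j.is_lt
        simp only [hY]
        rw [if_pos (by omega), if_pos (by omega)]
  have hYs : Y s = y := by
    funext j
    simp [hY, j.is_lt]
  rw [← hYs]
  exact main s

/-! ### The Fourier coefficient as the box integral `I(0)` -/

/-- `e_{-h}(x) = e^{-2πi h·x}` for real `x`. [folklore] -/
private theorem mFourier_neg_apply_coe (h : Fin s → ℤ) (x : Fin s → ℝ) :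
    mFourier (-h) (fun j => (x j : UnitAddCircle)) =
      cexp (-(2 * π * I * ∑ j, (h j : ℂ) * shiftPt x 0 j)) := by
  simp only [mFourier, ContinuousMap.coe_mk, Pi.neg_apply, fourier_coe_apply]
  rw [← Complex.exp_sum]
  congr 1
  rw [mul_sum, ← sum_neg_distrib]
  refine sum_congr rfl fun j _ => ?_
  simp only [shiftPt, Pi.zero_apply, ofReal_zero, zero_mul, add_zero]
  push_cast
  ring

/-- `f̂(h) = I(0)` when `f` on `𝕋ˢ` and `F` on `ℂˢ` agree on real points. [folklore] -/
private theorem mFourierCoeff_eq_boxInt {f : C(UnitAddTorus (Fin s), ℂ)} {F : (Fin s → ℂ) → ℂ}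
    (hfF : ∀ x : Fin s → ℝ, f (fun j => (x j : UnitAddCircle)) = F (fun j => (x j : ℂ)))
    (h : Fin s → ℤ) : mFourierCoeff f h = boxInt F h 0 := by
  rw [mFourierCoeff_eq_integral f h 0, boxInt, unitBox]
  have hset : {x : Fin s → ℝ | ∀ i, x i ∈ Ioc ((0 : Fin s → ℝ) i) ((0 : Fin s → ℝ) i + 1)} =
      Set.pi univ fun _ => Ioc (0 : ℝ) 1 := by
    ext x
    simp
  rw [hset]
  refine setIntegral_congr_fun (MeasurableSet.univ_pi fun _ => measurableSet_Ioc) fun x _ => ?_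
  have hx0 : shiftPt x 0 = fun j => (x j : ℂ) := by
    funext j
    simp [shiftPt]
  rw [smul_eq_mul, mFourier_neg_apply_coe, hfF, integrand, hx0, mul_comm]

/-! ### The decay of the Fourier coefficients -/

/-- **Fourier coefficients of a periodic function analytic in a polystrip decay exponentially**
[cite: Gallavotti1983, §5.11 Prop. 18(iii), eq. (5.11.15)] (stated there for functions holomorphic
on the multiannulus `e^{-ξ} < |z_j| < e^{ξ}`, i.e. `2π`-periodic with the uniform width `ξ`; the
per-coordinate widths `a_j` below come from the same one-variable contour shift, cf.
[cite: TrefethenWeideman2014, eq. (4.11)] for `s = 1`).  Let `F : ℂˢ → ℂ` be `1`-periodic in each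
variable, analytic in the polystrip `|Im z_j| < a_j` (`a_j > 0`) with `‖F‖ ≤ M` there, and let
`f ∈ C(𝕋ˢ)` be its restriction to real arguments.  Then for every `h ∈ ℤˢ`,
`‖f̂(h)‖ ≤ M · exp(-2π Σ_j a_j |h_j|)`. -/
theorem norm_mFourierCoeff_le_of_analytic_polystrip {f : C(UnitAddTorus (Fin s), ℂ)}
    {F : (Fin s → ℂ) → ℂ} {a : Fin s → ℝ} {M : ℝ} (ha : ∀ j, 0 < a j)
    (hd : DifferentiableOn ℂ F {z | ∀ j, |(z j).im| < a j})
    (hper : ∀ (z : Fin s → ℂ) (j : Fin s), F (z + Pi.single j 1) = F z)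
    (hM : ∀ z : Fin s → ℂ, (∀ j, |(z j).im| < a j) → ‖F z‖ ≤ M)
    (hfF : ∀ x : Fin s → ℝ, f (fun j => (x j : UnitAddCircle)) = F (fun j => (x j : ℂ)))
    (h : Fin s → ℤ) :
    ‖mFourierCoeff f h‖ ≤ M * Real.exp (-(2 * π * ∑ j, a j * |(h j : ℝ)|)) := by
  -- it suffices to prove the bound with `r • a`, `r < 1`, in place of `a`
  suffices key : ∀ r : ℝ, 0 < r → r < 1 →
      ‖mFourierCoeff f h‖ ≤ M * Real.exp (-(2 * π * ∑ j, r * a j * |(h j : ℝ)|)) by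
    have hcont : ContinuousAt
        (fun r : ℝ => M * Real.exp (-(2 * π * ∑ j, r * a j * |(h j : ℝ)|))) 1 := by
      fun_prop
    have hlim := hcont.tendsto.mono_left (nhdsWithin_le_nhds (s := Iio (1 : ℝ)))
    simp only [one_mul] at hlim
    refine ge_of_tendsto hlim ?_
    filter_upwards [Ioo_mem_nhdsLT zero_lt_one] with r hr using key r hr.1 hr.2
  intro r hr0 hr1
  -- shift the `j`-th contour to `Im z_j = ∓ r a_j` according to the sign of `h_j`
  set y : Fin s → ℝ := fun j => if 0 ≤ h j then -(r * a j) else r * a j with hy_def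
  have hra : ∀ j, r * a j < a j := fun j => by
    have := mul_lt_mul_of_pos_right hr1 (ha j)
    rwa [one_mul] at this
  have hy : ∀ j, |y j| < a j := by
    intro j
    simp only [hy_def]
    split_ifs
    · rw [abs_neg, abs_of_pos (mul_pos hr0 (ha j))]
      exact hra j
    · rw [abs_of_pos (mul_pos hr0 (ha j))]
      exact hra j
  have hexp : ∑ j, (h j : ℝ) * y j = -(∑ j, r * a j * |(h j : ℝ)|) := by
    rw [← sum_neg_distrib]
    refine sum_congr rfl fun j _ => ?_
    simp only [hy_def]
    split_ifs with hj
    · rw [abs_of_nonneg (by exact_mod_cast hj)]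
      ring
    · rw [abs_of_neg (by exact_mod_cast lt_of_not_ge hj)]
      ring
  rw [mFourierCoeff_eq_boxInt hfF h, ← boxInt_eq_boxInt_zero ha hd hper h hy]
  have H := norm_boxInt_le hM h hy
  rwa [hexp, mul_neg] at H

/-! ### The exponential weights `w_a(h) = e^{-2π Σ_j a_j |h_j|} = ∏_j q_j^{|h_j|}`, `q_j = e^{-2π a_j}` -/

section Weights

variable {d : Type*} [Fintype d]

/-- **Two-sided geometric series**: `Σ_{n ∈ ℤ} e^{-c|n|} = (1 + e^{-c})/(1 - e^{-c})` for `c > 0`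
(`= 1 + 2 Σ_{n ≥ 1} q^n`, `q = e^{-c}`; the one-dimensional factor in the proof of
[cite: Pillichshammer2021, Prop. 2], there with `q = ω^{λ a_j}`). -/
theorem hasSum_int_exp_neg_mul_abs {c : ℝ} (hc : 0 < c) :
    HasSum (fun n : ℤ => Real.exp (-(c * |(n : ℝ)|)))
      ((1 + Real.exp (-c)) / (1 - Real.exp (-c))) := by
  set q := Real.exp (-c) with hq
  have hq0 : 0 ≤ q := (Real.exp_pos _).le
  have hq1 : q < 1 := Real.exp_lt_one_iff.mpr (neg_lt_zero.mpr hc)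
  have hnat : ∀ n : ℕ, Real.exp (-(c * n)) = q ^ n := fun n => by
    rw [hq, ← Real.exp_nat_mul]
    congr 1
    ring
  have h1 : HasSum (fun n : ℕ => Real.exp (-(c * |((n : ℤ) : ℝ)|))) (1 - q)⁻¹ := by
    have e : (fun n : ℕ => Real.exp (-(c * |((n : ℤ) : ℝ)|))) = fun n => q ^ n := by
      funext n
      rw [Int.cast_natCast, Nat.abs_cast, hnat]
    rw [e]
    exact hasSum_geometric_of_lt_one hq0 hq1
  have h2 : HasSum (fun n : ℕ => Real.exp (-(c * |((-((n : ℤ) + 1) : ℤ) : ℝ)|)))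
      (q * (1 - q)⁻¹) := by
    have e : (fun n : ℕ => Real.exp (-(c * |((-((n : ℤ) + 1) : ℤ) : ℝ)|))) =
        fun n => q * q ^ n := by
      funext n
      rw [← pow_succ', ← hnat (n + 1)]
      push_cast
      rw [abs_neg, abs_of_nonneg (by positivity)]
    rw [e]
    exact (hasSum_geometric_of_lt_one hq0 hq1).mul_left q
  have e : (1 + q) / (1 - q) = (1 - q)⁻¹ + q * (1 - q)⁻¹ := by
    rw [div_eq_mul_inv, add_mul, one_mul]
  rw [e]
  exact HasSum.of_nat_of_neg_add_one h1 h2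

/-- `e^{-2π Σ_j a_j |h_j|} = ∏_j e^{-2π a_j |h_j|}`. [folklore] -/
private theorem exp_neg_polystrip_eq_prod (a : d → ℝ) (h : d → ℤ) :
    Real.exp (-(2 * π * ∑ j, a j * |(h j : ℝ)|)) = ∏ j, Real.exp (-(2 * π * a j * |(h j : ℝ)|)) := by
  rw [← Real.exp_sum, mul_sum, ← sum_neg_distrib]
  congr 1
  exact sum_congr rfl fun j _ => by ring

/-- For nonnegative summable `φᵢ : ℤ → ℝ`, every finite partial sum of `Σ_{𝐪 ∈ ℤᵈ} ∏ᵢ φᵢ(qᵢ)` is at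
most `∏ᵢ Σ_{n ∈ ℤ} φᵢ(n)` (expand the product of finite sums over a box containing the support).
[folklore] -/
private theorem sum_prod_le_prod_tsum {φ : d → ℤ → ℝ} (h0 : ∀ i n, 0 ≤ φ i n)
    (hs : ∀ i, Summable (φ i)) (Q : Finset (d → ℤ)) :
    ∑ q ∈ Q, ∏ i, φ i (q i) ≤ ∏ i, ∑' n, φ i n := by
  classical
  let T : Finset ℤ := Q.biUnion fun q => Finset.univ.image q
  have hQ : Q ⊆ Fintype.piFinset fun _ : d => T := by
    intro q hq
    rw [Fintype.mem_piFinset]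
    intro i
    exact Finset.mem_biUnion.mpr ⟨q, hq, Finset.mem_image.mpr ⟨i, Finset.mem_univ _, rfl⟩⟩
  calc ∑ q ∈ Q, ∏ i, φ i (q i)
      ≤ ∑ q ∈ Fintype.piFinset (fun _ : d => T), ∏ i, φ i (q i) :=
        Finset.sum_le_sum_of_subset_of_nonneg hQ fun q _ _ =>
          Finset.prod_nonneg fun i _ => h0 i (q i)
    _ = ∏ i, ∑ n ∈ T, φ i n := (Finset.prod_univ_sum (fun _ : d => T) φ).symm
    _ ≤ ∏ i, ∑' n, φ i n := by
        refine Finset.prod_le_prod (fun i _ => Finset.sum_nonneg fun n _ => h0 i n) fun i _ => ?_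
        exact (hs i).sum_le_tsum T fun n _ => h0 i n

/-- **The weights are summable over `ℤᵈ`** (`a_j > 0`): `Σ_{h ∈ ℤᵈ} e^{-2π Σ_j a_j|h_j|} < ∞`
(the product bound in the proof of [cite: Pillichshammer2021, Prop. 2]). -/
theorem summable_exp_neg_polystrip {a : d → ℝ} (ha : ∀ j, 0 < a j) :
    Summable fun h : d → ℤ => Real.exp (-(2 * π * ∑ j, a j * |(h j : ℝ)|)) := by
  simp_rw [exp_neg_polystrip_eq_prod]
  exact summable_of_sum_le (fun h => prod_nonneg fun j _ => (Real.exp_pos _).le)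
    (sum_prod_le_prod_tsum (φ := fun j (n : ℤ) => Real.exp (-(2 * π * a j * |(n : ℝ)|)))
      (fun _ _ => (Real.exp_pos _).le)
      fun j => (hasSum_int_exp_neg_mul_abs (mul_pos Real.two_pi_pos (ha j))).summable)

/-- **Product bound** (proof of [cite: Pillichshammer2021, Prop. 2], first display, with `λ = 1`,
`b_j = 1`, `ω^{a_j} = e^{-2π a_j}`):
`Σ_{h ∈ ℤᵈ} e^{-2π Σ_j a_j|h_j|} ≤ ∏_j (1 + e^{-2π a_j})/(1 - e^{-2π a_j})` (in fact equality
holds). -/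
theorem tsum_exp_neg_polystrip_le {a : d → ℝ} (ha : ∀ j, 0 < a j) :
    ∑' h : d → ℤ, Real.exp (-(2 * π * ∑ j, a j * |(h j : ℝ)|)) ≤
      ∏ j, (1 + Real.exp (-(2 * π * a j))) / (1 - Real.exp (-(2 * π * a j))) := by
  simp_rw [exp_neg_polystrip_eq_prod]
  refine (Real.tsum_le_of_sum_le (fun h => prod_nonneg fun j _ => (Real.exp_pos _).le)
    (sum_prod_le_prod_tsum (φ := fun j (n : ℤ) => Real.exp (-(2 * π * a j * |(n : ℝ)|)))
      (fun _ _ => (Real.exp_pos _).le)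
      fun j => (hasSum_int_exp_neg_mul_abs (mul_pos Real.two_pi_pos (ha j))).summable)).trans_eq
    ?_
  exact prod_congr rfl fun j _ => (hasSum_int_exp_neg_mul_abs (mul_pos Real.two_pi_pos (ha j))).tsum_eq

/-- The characters are multiplicative in the argument: `e_m(x + y) = e_m(x) e_m(y)`. [folklore] -/
private theorem mFourier_apply_add (m : d → ℤ) (x y : UnitAddTorus d) :
    mFourier m (x + y) = mFourier m x * mFourier m y := by
  simp only [mFourier, ContinuousMap.coe_mk, Pi.add_apply, fourier_apply, zsmul_add,
    AddCircle.toCircle_add, Circle.coe_mul, prod_mul_distrib]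

/-- `e_{-m}(-x) = e_m(x)`. [folklore] -/
private theorem mFourier_neg_apply_neg (m : d → ℤ) (x : UnitAddTorus d) :
    mFourier (-m) (-x) = mFourier m x := by
  simp only [mFourier, ContinuousMap.coe_mk, Pi.neg_apply, fourier_apply, zsmul_neg, neg_zsmul,
    neg_neg]

/-- **Fourier coefficients of a translate have the same size**: `‖(f(· + Δ))^(h)‖ ≤ ‖f̂(h)‖`
(in fact `(f(· + Δ))^(h) = e_h(Δ) f̂(h)`; translation invariance of Haar measure on `𝕋ᵈ`).
[folklore] -/
private theorem norm_mFourierCoeff_comp_add_le (f : UnitAddTorus d → ℂ) (Δ : UnitAddTorus d)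
    (h : d → ℤ) : ‖mFourierCoeff (fun x => f (x + Δ)) h‖ ≤ ‖mFourierCoeff f h‖ := by
  have H := integral_add_left_eq_self (μ := (volume : Measure (UnitAddTorus d)))
    (fun u => mFourier (-h) (u - Δ) • f u) Δ
  simp only [add_sub_cancel_left] at H
  have h1 : ∀ u : UnitAddTorus d, mFourier (-h) (u - Δ) = mFourier h Δ * mFourier (-h) u := by
    intro u
    rw [sub_eq_add_neg, mFourier_apply_add, mFourier_neg_apply_neg, mul_comm]
  have hΔ : (fun x : UnitAddTorus d => mFourier (-h) x • f (x + Δ)) =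
      fun x => mFourier (-h) x • f (Δ + x) := by
    funext x
    rw [add_comm x Δ]
  rw [mFourierCoeff, mFourierCoeff, hΔ, H]
  simp_rw [h1, mul_smul, integral_smul, norm_smul]
  refine mul_le_of_le_one_left (norm_nonneg _) ?_
  exact ((mFourier h).norm_coe_le_norm Δ).trans_eq mFourier_norm

end Weights

/-! ### Lattice rules for periodic functions analytic in a polystrip -/

/-- **Absolute convergence of the Fourier series** [cite: Gallavotti1983, §5.11 Prop. 18(iv)]
(coefficients bounded by `e^{-ξ|ν|}` sum absolutely): under the hypotheses of
`norm_mFourierCoeff_le_of_analytic_polystrip`, `Σ_h ‖f̂(h)‖ < ∞`. -/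
theorem summable_mFourierCoeff_of_analytic_polystrip {f : C(UnitAddTorus (Fin s), ℂ)}
    {F : (Fin s → ℂ) → ℂ} {a : Fin s → ℝ} {M : ℝ} (ha : ∀ j, 0 < a j)
    (hd : DifferentiableOn ℂ F {z | ∀ j, |(z j).im| < a j})
    (hper : ∀ (z : Fin s → ℂ) (j : Fin s), F (z + Pi.single j 1) = F z)
    (hM : ∀ z : Fin s → ℂ, (∀ j, |(z j).im| < a j) → ‖F z‖ ≤ M)
    (hfF : ∀ x : Fin s → ℝ, f (fun j => (x j : UnitAddCircle)) = F (fun j => (x j : ℂ))) :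
    Summable (mFourierCoeff f) :=
  Summable.of_norm_bounded ((summable_exp_neg_polystrip ha).mul_left M) fun h =>
    norm_mFourierCoeff_le_of_analytic_polystrip ha hd hper hM hfF h

/-- **Lattice rules for periodic functions analytic in a polystrip** — the error formula
[cite: Niederreiter1992, Thm. 5.3] (comparison form of eq. (5.4), `norm_latticeRule_sub_integral_le_of_le`)
combined with the coefficient decay [cite: Gallavotti1983, §5.11 Prop. 18(iii)]: if `F : ℂˢ → ℂ` is
`1`-periodic in each variable, analytic in `|Im z_j| < a_j` (`a_j > 0`) with `‖F‖ ≤ M` there, and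
`f ∈ C(𝕋ˢ)` is its restriction to real arguments, then for every `n ≥ 1` and `z ∈ ℤˢ`
`‖Q_{n,z}(f) - ∫_{𝕋ˢ} f‖ ≤ M · Σ_{0 ≠ h ∈ L⊥} e^{-2π Σ_j a_j |h_j|}`.
(The dual-lattice sum on the right is the squared worst-case error of `Q_{n,z}` in the Korobov
space of analytic functions with weights `ω^{a_j} = e^{-2π a_j}`, `b_j = 1`
[cite: Pillichshammer2021, Lemma 1]; here it bounds the error of the sup-norm class linearly.) -/
theorem norm_latticeRule_sub_integral_le_of_analytic_polystrip (n : ℕ) [NeZero n]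
    (z : Fin s → ℤ) {f : C(UnitAddTorus (Fin s), ℂ)} {F : (Fin s → ℂ) → ℂ} {a : Fin s → ℝ}
    {M : ℝ} (ha : ∀ j, 0 < a j) (hd : DifferentiableOn ℂ F {z | ∀ j, |(z j).im| < a j})
    (hper : ∀ (z : Fin s → ℂ) (j : Fin s), F (z + Pi.single j 1) = F z)
    (hM : ∀ z : Fin s → ℂ, (∀ j, |(z j).im| < a j) → ‖F z‖ ≤ M)
    (hfF : ∀ x : Fin s → ℝ, f (fun j => (x j : UnitAddCircle)) = F (fun j => (x j : ℂ))) :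
    ‖latticeRule n z f - ∫ x, f x‖ ≤
      M * ∑' h : ((dualLattice n z : Set (Fin s → ℤ)) \ {0} : Set (Fin s → ℤ)),
        Real.exp (-(2 * π * ∑ j, a j * |((h : Fin s → ℤ) j : ℝ)|)) := by
  refine norm_latticeRule_sub_integral_le_of_le n z
    (summable_mFourierCoeff_of_analytic_polystrip ha hd hper hM hfF)
    (b := fun h => M * Real.exp (-(2 * π * ∑ j, a j * |(h j : ℝ)|)))
    (fun h _ _ => norm_mFourierCoeff_le_of_analytic_polystrip ha hd hper hM hfF h) ?_
  rw [← tsum_mul_left]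
  exact (((summable_exp_neg_polystrip ha).subtype _).mul_left M).hasSum

/-- **Shifted lattice rules** `Q_{n,z,Δ}(f) = (1/n) Σ_i f(x_i + Δ)` obey the same bound (the
Fourier coefficients of a translate have the same modulus, and `∫ f(· + Δ) = ∫ f`): under the
hypotheses of `norm_latticeRule_sub_integral_le_of_analytic_polystrip`, for every `Δ ∈ 𝕋ˢ`,
`‖Q_{n,z,Δ}(f) - ∫_{𝕋ˢ} f‖ ≤ M · Σ_{0 ≠ h ∈ L⊥} e^{-2π Σ_j a_j |h_j|}`.
[cite: Niederreiter1992, Thm. 5.3] -/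
theorem norm_latticeRule_shift_sub_integral_le_of_analytic_polystrip (n : ℕ) [NeZero n]
    (z : Fin s → ℤ) {f : C(UnitAddTorus (Fin s), ℂ)} {F : (Fin s → ℂ) → ℂ} {a : Fin s → ℝ}
    {M : ℝ} (ha : ∀ j, 0 < a j) (hd : DifferentiableOn ℂ F {z | ∀ j, |(z j).im| < a j})
    (hper : ∀ (z : Fin s → ℂ) (j : Fin s), F (z + Pi.single j 1) = F z)
    (hM : ∀ z : Fin s → ℂ, (∀ j, |(z j).im| < a j) → ‖F z‖ ≤ M)
    (hfF : ∀ x : Fin s → ℝ, f (fun j => (x j : UnitAddCircle)) = F (fun j => (x j : ℂ)))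
    (Δ : UnitAddTorus (Fin s)) :
    ‖latticeRule n z (fun x => f (x + Δ)) - ∫ x, f x‖ ≤
      M * ∑' h : ((dualLattice n z : Set (Fin s → ℤ)) \ {0} : Set (Fin s → ℤ)),
        Real.exp (-(2 * π * ∑ j, a j * |((h : Fin s → ℤ) j : ℝ)|)) := by
  set g : C(UnitAddTorus (Fin s), ℂ) :=
    ⟨fun x => f (x + Δ), f.continuous.comp (continuous_id.add continuous_const)⟩ with hg
  have hgf : ∀ h, ‖mFourierCoeff g h‖ ≤ ‖mFourierCoeff f h‖ := fun h =>
    norm_mFourierCoeff_comp_add_le f Δ h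
  have hgs : Summable (mFourierCoeff g) :=
    Summable.of_norm_bounded (summable_mFourierCoeff_of_analytic_polystrip ha hd hper hM hfF).norm
      hgf
  have hint : ∫ x, g x = ∫ x, f x := by
    simp only [hg, ContinuousMap.coe_mk]
    exact integral_add_right_eq_self (μ := (volume : Measure (UnitAddTorus (Fin s)))) f Δ
  have key : ‖latticeRule n z g - ∫ x, g x‖ ≤
      M * ∑' h : ((dualLattice n z : Set (Fin s → ℤ)) \ {0} : Set (Fin s → ℤ)),
        Real.exp (-(2 * π * ∑ j, a j * |((h : Fin s → ℤ) j : ℝ)|)) := by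
    refine norm_latticeRule_sub_integral_le_of_le n z hgs
      (b := fun h => M * Real.exp (-(2 * π * ∑ j, a j * |(h j : ℝ)|)))
      (fun h _ _ => (hgf h).trans (norm_mFourierCoeff_le_of_analytic_polystrip ha hd hper hM hfF h))
      ?_
    rw [← tsum_mul_left]
    exact (((summable_exp_neg_polystrip ha).subtype _).mul_left M).hasSum
  rw [hint] at key
  exact key

/-! ### Certified evaluation of the dual-lattice sum: a finite box plus an explicit tail -/

section Tail

variable {d : Type*} [Fintype d]

/-- `e^{-c n} = (e^{-c})^n`. [folklore] -/
private theorem exp_neg_mul_natCast (c : ℝ) (n : ℕ) :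
    Real.exp (-(c * n)) = Real.exp (-c) ^ n := by
  rw [← Real.exp_nat_mul]
  congr 1
  ring

/-- **Tail of the two-sided geometric series**: `Σ_{m ∈ ℤ, |m| > H} e^{-c|m|} = 2 q^{H+1}/(1-q)`,
`q = e^{-c}`, `c > 0`. [folklore] -/
private theorem hasSum_int_exp_neg_mul_abs_tail {c : ℝ} (hc : 0 < c) (H : ℕ) :
    HasSum (fun m : ℤ => if (H : ℤ) < |m| then Real.exp (-(c * |(m : ℝ)|)) else 0)
      (2 * Real.exp (-c) ^ (H + 1) / (1 - Real.exp (-c))) := by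
  set q := Real.exp (-c) with hq
  have hq0 : 0 ≤ q := (Real.exp_pos _).le
  have hq1 : q < 1 := Real.exp_lt_one_iff.mpr (neg_lt_zero.mpr hc)
  set g : ℕ → ℝ := fun k => if H < k then q ^ k else 0 with hg
  have hgs : HasSum g (q ^ (H + 1) * (1 - q)⁻¹) := by
    have h0 : ∑ i ∈ Finset.range (H + 1), g i = 0 :=
      Finset.sum_eq_zero fun i hi => by
        rw [Finset.mem_range] at hi
        rw [hg]
        simp only [ite_eq_right_iff]
        intro h
        omega
    have h1 : HasSum (fun k => g (k + (H + 1))) (q ^ (H + 1) * (1 - q)⁻¹) := by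
      have e : (fun k => g (k + (H + 1))) = fun k => q ^ (H + 1) * q ^ k := by
        funext k
        rw [hg]
        simp only
        rw [if_pos (by omega), pow_add, mul_comm]
      rw [e]
      exact (hasSum_geometric_of_lt_one hq0 hq1).mul_left _
    exact (hasSum_nat_add_iff' (f := g) (H + 1)).mp (by rw [h0, sub_zero]; exact h1)
  have hgs' : HasSum (fun k => g (k + 1)) (q ^ (H + 1) * (1 - q)⁻¹) := by
    have h2 := (hasSum_nat_add_iff' (f := g) 1).mpr hgs
    rwa [Finset.sum_range_one, show g 0 = 0 by rw [hg]; simp, sub_zero] at h2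
  have e1 : (fun k : ℕ => if (H : ℤ) < |((k : ℤ))| then Real.exp (-(c * |((k : ℤ) : ℝ)|)) else 0) =
      g := by
    funext k
    rw [hg, Int.cast_natCast, Nat.abs_cast, Nat.abs_cast, exp_neg_mul_natCast, ← hq]
    simp only [Nat.cast_lt]
  have e2 : (fun k : ℕ => if (H : ℤ) < |((-((k : ℤ) + 1) : ℤ))| then
      Real.exp (-(c * |((-((k : ℤ) + 1) : ℤ) : ℝ)|)) else 0) = fun k => g (k + 1) := by
    funext k
    have i1 : |((-((k : ℤ) + 1) : ℤ))| = ((k + 1 : ℕ) : ℤ) := by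
      rw [abs_neg]
      push_cast
      exact abs_of_nonneg (by positivity)
    have i2 : |((-((k : ℤ) + 1) : ℤ) : ℝ)| = ((k + 1 : ℕ) : ℝ) := by
      push_cast
      rw [abs_neg]
      exact abs_of_nonneg (by positivity)
    rw [i1, i2, exp_neg_mul_natCast, ← hq, hg]
    simp only [Nat.cast_lt]
  have etot : 2 * q ^ (H + 1) / (1 - q) = q ^ (H + 1) * (1 - q)⁻¹ + q ^ (H + 1) * (1 - q)⁻¹ := by
    rw [div_eq_mul_inv]
    ring
  rw [etot]
  refine HasSum.of_nat_of_neg_add_one ?_ ?_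
  · rw [e1]
    exact hgs
  · rw [e2]
    exact hgs'

/-- **Box + tail majorant of the dual-lattice sum** (a finitely checkable upper bound): for every
box `B(H) = ∏_j [-H_j, H_j]`,
`Σ_{0 ≠ h ∈ L⊥} w_a(h) ≤ Σ_{0 ≠ h ∈ L⊥ ∩ B(H)} w_a(h) + Σ_j [2 q_j^{H_j+1}/(1-q_j)] ∏_{i ≠ j} (1+q_i)/(1-q_i)`,
`w_a(h) = e^{-2π Σ_j a_j|h_j|}`, `q_j = e^{-2π a_j}`: outside the box the lattice constraint is dropped
and the union bound over the coordinate leaving the box is taken; each term is then a product of a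
one-dimensional geometric tail and full one-dimensional sums (the product step as in the proof of
[cite: Pillichshammer2021, Prop. 2]; the decomposition itself is elementary). [folklore] -/
theorem tsum_dualLattice_exp_neg_polystrip_le_box_add_tail (n : ℕ) (z : d → ℤ) {a : d → ℝ}
    (ha : ∀ j, 0 < a j) (H : d → ℕ) [DecidableEq d] :
    ∑' h : ((dualLattice n z : Set (d → ℤ)) \ {0} : Set (d → ℤ)),
        Real.exp (-(2 * π * ∑ j, a j * |((h : d → ℤ) j : ℝ)|)) ≤
      (∑ h ∈ (Fintype.piFinset fun j => Finset.Icc (-(H j : ℤ)) (H j)).filter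
          (fun h => h ≠ 0 ∧ h ∈ dualLattice n z), Real.exp (-(2 * π * ∑ j, a j * |(h j : ℝ)|))) +
      ∑ j, 2 * Real.exp (-(2 * π * a j)) ^ (H j + 1) / (1 - Real.exp (-(2 * π * a j))) *
        ∏ i ∈ univ.erase j, (1 + Real.exp (-(2 * π * a i))) / (1 - Real.exp (-(2 * π * a i))) := by
  classical
  set w : (d → ℤ) → ℝ := fun h => Real.exp (-(2 * π * ∑ j, a j * |(h j : ℝ)|)) with hw
  have hw0 : ∀ h, 0 ≤ w h := fun h => (Real.exp_pos _).le
  set box : Finset (d → ℤ) := Fintype.piFinset fun j => Finset.Icc (-(H j : ℤ)) (H j) with hbox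
  have hc : ∀ j, 0 < 2 * π * a j := fun j => mul_pos Real.two_pi_pos (ha j)
  -- it suffices to bound the finite partial sums
  refine Real.tsum_le_of_sum_le (fun _ => hw0 _) fun Q => ?_
  set Q' : Finset (d → ℤ) := Q.map (Function.Embedding.subtype _) with hQ'
  have hsum : ∑ h ∈ Q, w (h : d → ℤ) = ∑ h ∈ Q', w h := by
    rw [hQ', Finset.sum_map]
    rfl
  have hQ'S : ∀ h ∈ Q', h ≠ 0 ∧ h ∈ dualLattice n z := by
    intro h hh
    rw [hQ', Finset.mem_map] at hh
    obtain ⟨x, _, rfl⟩ := hh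
    have hx := x.2
    simp only [Set.mem_sdiff, Set.mem_singleton_iff, SetLike.mem_coe] at hx
    exact ⟨hx.2, hx.1⟩
  rw [hsum, ← Finset.sum_filter_add_sum_filter_not Q' (fun h => h ∈ box)]
  refine add_le_add ?_ ?_
  · -- inside the box: a sub-sum of the stated finite sum
    refine Finset.sum_le_sum_of_subset_of_nonneg (fun h hh => ?_) fun h _ _ => hw0 h
    rw [Finset.mem_filter] at hh ⊢
    exact ⟨hh.2, hQ'S h hh.1⟩
  · -- outside the box: union bound over the coordinate that leaves the box
    have hpt : ∀ h ∈ Q', (if h ∉ box then w h else 0) ≤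
        ∑ j, if (H j : ℤ) < |h j| then w h else 0 := by
      intro h _
      have hnn : ∀ i, 0 ≤ (if (H i : ℤ) < |h i| then w h else 0) := fun i => by
        split_ifs
        · exact hw0 h
        · exact le_rfl
      by_cases hb : h ∈ box
      · rw [if_neg (not_not_intro hb)]
        exact Finset.sum_nonneg fun i _ => hnn i
      · rw [if_pos hb]
        have hj : ∃ j, (H j : ℤ) < |h j| := by
          by_contra hcon
          push Not at hcon
          exact hb (Fintype.mem_piFinset.mpr fun j => Finset.mem_Icc.mpr (abs_le.mp (hcon j)))
        obtain ⟨j, hj⟩ := hj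
        calc w h = if (H j : ℤ) < |h j| then w h else 0 := by rw [if_pos hj]
          _ ≤ ∑ i, if (H i : ℤ) < |h i| then w h else 0 :=
            Finset.single_le_sum (f := fun i => if (H i : ℤ) < |h i| then w h else 0)
              (fun i _ => hnn i) (Finset.mem_univ j)
    calc ∑ h ∈ Q'.filter (fun h => h ∉ box), w h
        = ∑ h ∈ Q', if h ∉ box then w h else 0 := Finset.sum_filter _ _
      _ ≤ ∑ h ∈ Q', ∑ j, if (H j : ℤ) < |h j| then w h else 0 := Finset.sum_le_sum hpt
      _ = ∑ j, ∑ h ∈ Q', if (H j : ℤ) < |h j| then w h else 0 := Finset.sum_comm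
      _ = ∑ j, ∑ h ∈ Q'.filter (fun h => (H j : ℤ) < |h j|), w h := by
          simp_rw [Finset.sum_filter]
      _ ≤ _ := Finset.sum_le_sum fun j _ => ?_
    -- one coordinate `j` outside `[-H_j, H_j]`, the others free
    let φ : d → ℤ → ℝ := fun i m =>
      if i = j then (if (H j : ℤ) < |m| then Real.exp (-(2 * π * a j * |(m : ℝ)|)) else 0)
      else Real.exp (-(2 * π * a i * |(m : ℝ)|))
    have hφ0 : ∀ i m, 0 ≤ φ i m := fun i m => by
      simp only [φ]
      split_ifs <;> first | exact (Real.exp_pos _).le | exact le_rfl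
    have hφj : HasSum (φ j) (2 * Real.exp (-(2 * π * a j)) ^ (H j + 1) /
        (1 - Real.exp (-(2 * π * a j)))) := by
      have e : φ j = fun m : ℤ => if (H j : ℤ) < |m| then Real.exp (-(2 * π * a j * |(m : ℝ)|))
          else 0 := by
        funext m
        simp only [φ, if_pos rfl]
      rw [e]
      exact hasSum_int_exp_neg_mul_abs_tail (hc j) (H j)
    have hφi : ∀ i, i ≠ j → HasSum (φ i) ((1 + Real.exp (-(2 * π * a i))) /
        (1 - Real.exp (-(2 * π * a i)))) := fun i hi => by
      have e : φ i = fun m : ℤ => Real.exp (-(2 * π * a i * |(m : ℝ)|)) := by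
        funext m
        simp only [φ, if_neg hi]
      rw [e]
      exact hasSum_int_exp_neg_mul_abs (hc i)
    have hφs : ∀ i, Summable (φ i) := fun i => by
      by_cases hi : i = j
      · subst hi
        exact hφj.summable
      · exact (hφi i hi).summable
    have hwφ : ∀ h ∈ Q'.filter (fun h => (H j : ℤ) < |h j|), w h = ∏ i, φ i (h i) := by
      intro h hh
      rw [Finset.mem_filter] at hh
      rw [hw]
      simp only
      rw [exp_neg_polystrip_eq_prod]
      refine prod_congr rfl fun i _ => ?_
      by_cases hi : i = j
      · subst hi
        simp only [φ, if_pos rfl, if_pos hh.2]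
      · simp only [φ, if_neg hi]
    calc ∑ h ∈ Q'.filter (fun h => (H j : ℤ) < |h j|), w h
        = ∑ h ∈ Q'.filter (fun h => (H j : ℤ) < |h j|), ∏ i, φ i (h i) := Finset.sum_congr rfl hwφ
      _ ≤ ∏ i, ∑' m, φ i m := sum_prod_le_prod_tsum hφ0 hφs _
      _ = (∑' m, φ j m) * ∏ i ∈ univ.erase j, ∑' m, φ i m :=
          (Finset.mul_prod_erase univ (fun i => ∑' m, φ i m) (Finset.mem_univ j)).symm
      _ = _ := by
          rw [hφj.tsum_eq]
          congr 1
          exact prod_congr rfl fun i hi => (hφi i (Finset.ne_of_mem_erase hi)).tsum_eq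

end Tail

end Literature.Analysis.Quadrature
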